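import Summits.Ventures.DiscreteObjects.PP12.InvolutionLift

/-!
# PP(12): the live cell `|G| = 2` as a finite array statement, and the rigid endgame restated (kernel)
Framing: lottery ticket; floor = certified bounds/negative ranges.

Cell pub-namedobj (venture DiscreteObjects), target (M), designs gen 9.  `LiveCells.lean` (p-typed) proved: Janko–van Trung's
`{2,3}`-group theorem (named fact) + `NoInvolutionOrder12` + `NoOrderThreeOrder12` ⇒ every collineation group of a projective
plane of order 12 is trivial.  With `InvolutionLift.noInvolutionOrder12_of_no_liftableZ2` the involution cell is now implied by a
FINITE statement about incidence arrays, named here **`NoLiftableSTD2_12_6`**: no `π : STD.IncArray 12 6` with `STD.IsSTD 2 π`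
admits a GF(2) voltage `φ : Fin 12 → Fin 6 → Fin 12 → ZMod 2` solving the lift system `STD.LiftableZ2 π φ`.  So
(`card_collineationGroup_eq_one_of_noLiftable`): GIVEN the printed `{2,3}`-group theorem, the array statement
`NoLiftableSTD2_12_6` and the census statement `NoOrderThreeOrder12`, a putative projective plane of order 12 is rigid.  The array
statement is NOT proved (STD₂[12;6] are not classified; the census decides liftability per STD found, two engines); it is the
typed residue of family F-INV2.  Nothing else is assumed; no `sorry`.
-/

namespace Summit.Ventures.DiscreteObjects.PP12

open Configuration Literature.Combinatorics.Designs Summit.Ventures.DiscreteObjects.STD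

/-- **Finite census statement (typed, NOT proved): no liftable STD₂[12;6].**  No 12 × 12 incidence array of permutations of
`Fin 6` satisfying the STD₂ axioms admits a `ZMod 2` voltage on its flags solving the GF(2) lift system. -/
def NoLiftableSTD2_12_6 : Prop :=
  ∀ π : IncArray 12 6, IsSTD 2 π → ∀ φ : Fin 12 → Fin 6 → Fin 12 → ZMod 2, ¬ LiftableZ2 π φ

/-- The array statement implies the live-cell statement `NoInvolutionOrder12`. -/
theorem noInvolutionOrder12_of_noLiftable (h : NoLiftableSTD2_12_6) : NoInvolutionOrder12 :=
  Collineation.noInvolutionOrder12_of_no_liftableZ2 h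

/-- **Rigid endgame, v2.**  Janko–van Trung's `{2,3}`-group theorem (named fact), the finite array statement
`NoLiftableSTD2_12_6` and the census statement `NoOrderThreeOrder12` together force every collineation group of a projective
plane of order 12 to be trivial. -/
theorem card_collineationGroup_eq_one_of_noLiftable (hJvT : CollineationGroupIsTwoThreeGroup)
    (h2 : NoLiftableSTD2_12_6) (h3 : NoOrderThreeOrder12)
    (P L : Type) [Membership P L] [Fintype P] [Fintype L] [ProjectivePlane P L] (h12 : ProjectivePlane.order P L = 12)
    (G : Type) [Group G] [Fintype G] [MulAction G P] [MulAction G L] (hG : IsCollineationGroup G P L) :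
    Fintype.card G = 1 :=
  card_collineationGroup_eq_one_of_cells_empty hJvT (noInvolutionOrder12_of_noLiftable h2) h3 P L h12 G hG

end Summit.Ventures.DiscreteObjects.PP12
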